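import Mathlib
import Summits.Ventures.PercRepro2.Defs
import Summits.Ventures.PercRepro2.Graph
import Summits.Ventures.PercRepro2.OneColourSwitch
import Summits.Ventures.PercRepro2.OneColourSwitchFibre
import Summits.Ventures.PercRepro2.M9PendantFibreSign

/-!
# A pinned double edge identifies its endpoints: `m9` with doubly attached marks
(blind cell PercRepro2, p3 g16, 2026-08-27; `proofs/P3-CPNC.md` §13j (4))

On a typed fibre (`OneColourSwitch.fibre F z`; `W`-colour = `OneColourSwitch.flipOn F ω`) a pinned
edge with `z e = true` is open in BOTH colours (a «double» edge).  If `e₀ = {r, u}` and `e₁ = {s, w}`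
are such edges, then `r ~ u` and `s ~ w` in both colours on every configuration of the fibre, so the
fibre sign form of `m9` with the marks `p, q, r, s` EQUALS the one with the marks `p, q, u, w`
(`m9SignSumF_eq_of_double_edges`).  Reading (§13j): attaching `r`, `s` to any instance with marks
`p, q, u, w` by pinned double leaf edges produces an instance with the 2-separator `{u, w}` between
the pairs and the SAME `m9` sum — the move `m9` on the 2-separated typed instances is the move on
all of them; separator size one (the cut vertex, `CutVertexM9.lean`) is the separation class that
decouples.  Own work; std axioms.
-/

namespace Summit.Ventures.PercRepro2

namespace CutVertexM9

open Finset Classical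

variable {V : Type*} {E : Type*} {ends : E → Sym2 V}

/-- An open edge between `r` and `u` identifies them for connectivity. -/
lemma conn_iff_of_openEdge {ω : Config E} {e₀ : E} {r u : V} (he : ω e₀ = true)
    (hends : ends e₀ = s(r, u)) (x : V) : Conn ends ω r x ↔ Conn ends ω u x :=
  ⟨fun h => conn_trans (conn_symm (conn_of_openAdj ⟨e₀, he, hends⟩)) h,
    fun h => conn_trans (conn_of_openAdj ⟨e₀, he, hends⟩) h⟩

/-- A pinned edge with `z e = true` is open on the fibre. -/
lemma fibre_open_of_pinned_true {F : Set E} {z ω : Config E} (hω : ω ∈ OneColourSwitch.fibre F z)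
    {e : E} (he : e ∉ F) (hz : z e = true) : ω e = true := by
  have h : ω e = z e := hω e he
  rw [h, hz]

/-- A pinned edge with `z e = true` is open in the `W`-colour of the fibre too. -/
lemma flipOn_open_of_pinned_true {F : Set E} {z ω : Config E}
    (hω : ω ∈ OneColourSwitch.fibre F z) {e : E} (he : e ∉ F) (hz : z e = true) :
    OneColourSwitch.flipOn F ω e = true := by
  rw [OneColourSwitch.flipOn_of_notMem he]
  exact fibre_open_of_pinned_true hω he hz

/-- Connectivity is symmetric. -/
lemma conn_comm_iff {ω : Config E} {a b : V} : Conn ends ω a b ↔ Conn ends ω b a :=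
  ⟨conn_symm, conn_symm⟩

section Sum

variable [Fintype E] [DecidableEq E]

/-- **A pinned double edge identifies its endpoints in the `m9` fibre sum**: if `e₀ = {r, u}` and
`e₁ = {s, w}` are pinned open (`z = true`, not free), the fibre sign form with the marks
`p, q, r, s` equals the one with the marks `p, q, u, w`. -/
theorem m9SignSumF_eq_of_double_edges (F : Set E) (z : Config E) {p q r s u w : V} {e₀ e₁ : E}
    (h₀ : e₀ ∉ F) (hz₀ : z e₀ = true) (hends₀ : ends e₀ = s(r, u))
    (h₁ : e₁ ∉ F) (hz₁ : z e₁ = true) (hends₁ : ends e₁ = s(s, w)) :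
    OneColourSwitch.m9SignSumF ends F z p q r s = OneColourSwitch.m9SignSumF ends F z p q u w := by
  unfold OneColourSwitch.m9SignSumF
  refine Finset.sum_congr rfl fun ω _ => ?_
  by_cases hω : ω ∈ OneColourSwitch.fibre F z
  · -- on the fibre both pinned edges are open in both colours
    have hr : ∀ x, Conn ends ω r x ↔ Conn ends ω u x :=
      conn_iff_of_openEdge (fibre_open_of_pinned_true hω h₀ hz₀) hends₀
    have hs : ∀ x, Conn ends ω s x ↔ Conn ends ω w x :=
      conn_iff_of_openEdge (fibre_open_of_pinned_true hω h₁ hz₁) hends₁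
    have hr' : ∀ x, Conn ends (OneColourSwitch.flipOn F ω) r x ↔
        Conn ends (OneColourSwitch.flipOn F ω) u x :=
      conn_iff_of_openEdge (flipOn_open_of_pinned_true hω h₀ hz₀) hends₀
    have hs' : ∀ x, Conn ends (OneColourSwitch.flipOn F ω) s x ↔
        Conn ends (OneColourSwitch.flipOn F ω) w x :=
      conn_iff_of_openEdge (flipOn_open_of_pinned_true hω h₁ hz₁) hends₁
    have hrx : ∀ x, Conn ends ω x r ↔ Conn ends ω x u := fun x => by
      rw [conn_comm_iff (ends := ends) (ω := ω), hr x, conn_comm_iff (ends := ends) (ω := ω)]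
    have hsx : ∀ x, Conn ends ω x s ↔ Conn ends ω x w := fun x => by
      rw [conn_comm_iff (ends := ends) (ω := ω), hs x, conn_comm_iff (ends := ends) (ω := ω)]
    have hrx' : ∀ x, Conn ends (OneColourSwitch.flipOn F ω) x r ↔
        Conn ends (OneColourSwitch.flipOn F ω) x u := fun x => by
      rw [conn_comm_iff (ends := ends) (ω := OneColourSwitch.flipOn F ω), hr' x,
        conn_comm_iff (ends := ends) (ω := OneColourSwitch.flipOn F ω)]
    have hsx' : ∀ x, Conn ends (OneColourSwitch.flipOn F ω) x s ↔
        Conn ends (OneColourSwitch.flipOn F ω) x w := fun x => by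
      rw [conn_comm_iff (ends := ends) (ω := OneColourSwitch.flipOn F ω), hs' x,
        conn_comm_iff (ends := ends) (ω := OneColourSwitch.flipOn F ω)]
    -- the separations and the pair bits agree
    have hsep : OneColourSwitch.sep2F ends F p q r s ω ↔
        OneColourSwitch.sep2F ends F p q u w ω := by
      simp only [OneColourSwitch.sep2F, OneColourSwitch.sepY, hrx, hsx, hrx', hsx']
    have hrs : OneColourSwitch.sigmaF ends F ω r s = OneColourSwitch.sigmaF ends F ω u w := by
      simp only [OneColourSwitch.sigmaF, hr, hsx, hr', hsx']
    rw [hsep, hrs]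
  · rw [if_neg (fun h => hω h.1), if_neg (fun h => hω h.1)]

end Sum

end CutVertexM9

end Summit.Ventures.PercRepro2
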